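import Summits.HubbardSuperconductivity.HubbardSuperconductivity.Theorems.BalabanIRBirBdGPhaseCoercivityFourier

/-!
# Route BalabanIR — crux 3 `BirBdGPhaseCoercivity` (item `stmt-HubbardSuperconductivity-2081`):
# the Lyapunov deficit bound — scalar inequalities and plane-wave bookkeeping

Generic lemmas for the momentum-space evaluation of the Lyapunov (BCS-duality) deficit bound
(`lyap_deficit`), in the scaled-unitary setting `A^ = N⁻¹ W A Wᴴ`, `Wᴴ W = W Wᴴ = N` of the file
`…Fourier`:

* `lyap_scalar_amgm` — `0 ≤ 2 Re (d̄ a) + e |a|² + |d|²/e` (`e > 0`): completing the square, the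
  per-mode admissibility of `Φ = Σ |D^|²/(E + E')`;
* `lyap_bergstrom` — for `E, E' ≥ m > 0`:
  `|Δ|²/E + |Δ'|²/E' - |Δ + Δ'|²/(E + E') ≥ (m/2) |Δ/E - Δ'/E'|²`
  (Bergström's identity `|Δ|²/E + |Δ'|²/E' - |Δ+Δ'|²/(E+E') = |ΔE' - Δ'E|²/(E E'(E + E'))` and
  `E E'/(E + E') ≥ m/2`);
* `lyap_trace_conjTranspose_mul` — `Tr (Pᴴ Q) = Σ_{ij} conj P_{ij} Q_{ij}`; `hat_add` — additivity of
  the conjugation (its companion `hat_sub'` lives in the file `…FirstOrder`);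
* `lyap_sum_normSq_hat` — the conjugation preserves the Hilbert–Schmidt norm;
* `lyap_row_normSq`, `lyap_col_normSq` — unit row/column sums of `|V_{ij}|²` for unitary `V`;
* `lyap_admissible` — with `E_pos = N⁻¹ Wᴴ diag(E) W` and `D^` the transform of `D`:
  `0 ≤ 2 Re Tr (Dᴴ α) + Re Tr (αᴴ (E_pos α + α E_pos)) + Σ_{kk'} |D^_{kk'}|²/(E_k + E_{k'})`
  for every `α` — the hypothesis `hΦ` of `lyap_deficit` with the optimal `Φ`.

References: R. Bhatia, *Matrix Analysis* (Springer 1997), §I.2 (Hilbert–Schmidt norm, unitary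
invariance). No definition is introduced.
-/

noncomputable section

namespace Summit.HubbardSuperconductivity.HubbardSuperconductivity.Theorems

namespace BirBdG

open Matrix Finset
open scoped ComplexConjugate ComplexOrder

/-! ### Scalar inequalities -/

section Scalar

/-- Completing the square: `0 ≤ 2 Re (conj d · a) + e |a|² + |d|²/e` for `e > 0`. [folklore] -/
theorem lyap_scalar_amgm {e : ℝ} (he : 0 < e) (d a : ℂ) :
    0 ≤ 2 * (conj d * a).re + e * ‖a‖ ^ 2 + ‖d‖ ^ 2 / e := by
  have h1 : |(conj d * a).re| ≤ ‖d‖ * ‖a‖ := by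
    calc |(conj d * a).re| ≤ ‖conj d * a‖ := Complex.abs_re_le_norm _
      _ = ‖d‖ * ‖a‖ := by rw [norm_mul, Complex.norm_conj]
  have h2 : 0 ≤ (e * ‖a‖ - ‖d‖) ^ 2 / e := by positivity
  have h3 : (e * ‖a‖ - ‖d‖) ^ 2 / e = e * ‖a‖ ^ 2 - 2 * (‖d‖ * ‖a‖) + ‖d‖ ^ 2 / e := by
    field_simp
    ring
  have h4 := neg_abs_le (conj d * a).re
  linarith

/-- **Bergström's inequality with the harmonic-mean weight**: for `E, E' ≥ m > 0` and complex
`Δ, Δ'`, `(m/2) |Δ/E - Δ'/E'|² ≤ |Δ|²/E + |Δ'|²/E' - |Δ + Δ'|²/(E + E')`. [folklore] -/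
theorem lyap_bergstrom {E E' m : ℝ} (hm : 0 < m) (hE : m ≤ E) (hE' : m ≤ E') (Δ Δ' : ℂ) :
    m / 2 * ‖Δ / (E : ℂ) - Δ' / (E' : ℂ)‖ ^ 2 ≤
      ‖Δ‖ ^ 2 / E + ‖Δ'‖ ^ 2 / E' - ‖Δ + Δ'‖ ^ 2 / (E + E') := by
  have hEpos : 0 < E := lt_of_lt_of_le hm hE
  have hE'pos : 0 < E' := lt_of_lt_of_le hm hE'
  -- pass to real coordinates
  set a := Δ.re with ha
  set b := Δ.im with hb
  set a' := Δ'.re with ha'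
  set b' := Δ'.im with hb'
  have n1 : ‖Δ‖ ^ 2 = a ^ 2 + b ^ 2 := by
    rw [Complex.sq_norm, Complex.normSq_apply]; ring
  have n2 : ‖Δ'‖ ^ 2 = a' ^ 2 + b' ^ 2 := by
    rw [Complex.sq_norm, Complex.normSq_apply]; ring
  have n3 : ‖Δ + Δ'‖ ^ 2 = (a + a') ^ 2 + (b + b') ^ 2 := by
    rw [Complex.sq_norm, Complex.normSq_apply, Complex.add_re, Complex.add_im]; ring
  have n4 : ‖Δ / (E : ℂ) - Δ' / (E' : ℂ)‖ ^ 2 = (a / E - a' / E') ^ 2 + (b / E - b' / E') ^ 2 := by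
    rw [Complex.sq_norm, Complex.normSq_apply, Complex.sub_re, Complex.sub_im,
      Complex.div_ofReal_re, Complex.div_ofReal_re, Complex.div_ofReal_im, Complex.div_ofReal_im]
    ring
  rw [n1, n2, n3, n4]
  -- the polynomial inequality: with `K = |Δ E' - Δ' E|²`,
  -- `LHS = m K / (2 E² E'²)`, `RHS = K / (E E' (E + E'))`, and `2 E E' ≥ m (E + E')`.
  set K := (a * E' - a' * E) ^ 2 + (b * E' - b' * E) ^ 2 with hK
  have hKnn : 0 ≤ K := by positivity
  have hL : m / 2 * ((a / E - a' / E') ^ 2 + (b / E - b' / E') ^ 2) = m * K / (2 * E ^ 2 * E' ^ 2) := by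
    rw [hK]
    field_simp
  have hR : (a ^ 2 + b ^ 2) / E + (a' ^ 2 + b' ^ 2) / E' - ((a + a') ^ 2 + (b + b') ^ 2) / (E + E') =
      K / (E * E' * (E + E')) := by
    rw [hK]
    field_simp
    ring
  rw [hL, hR, div_le_div_iff₀ (by positivity) (by positivity)]
  have h1 : 0 ≤ E * (E' - m) + E' * (E - m) :=
    add_nonneg (mul_nonneg hEpos.le (sub_nonneg.2 hE')) (mul_nonneg hE'pos.le (sub_nonneg.2 hE))
  have h2 : m * (E + E') ≤ 2 * E * E' := by nlinarith [h1]
  have key : m * (E * E' * (E + E')) ≤ 2 * E ^ 2 * E' ^ 2 := by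
    calc m * (E * E' * (E + E')) = (E * E') * (m * (E + E')) := by ring
      _ ≤ (E * E') * (2 * E * E') := mul_le_mul_of_nonneg_left h2 (by positivity)
      _ = 2 * E ^ 2 * E' ^ 2 := by ring
  calc m * K * (E * E' * (E + E')) = K * (m * (E * E' * (E + E'))) := by ring
    _ ≤ K * (2 * E ^ 2 * E' ^ 2) := mul_le_mul_of_nonneg_left key hKnn
    _ = K * (2 * E ^ 2 * E' ^ 2) := rfl

end Scalar

/-! ### Plane-wave bookkeeping -/

section Scaled

variable {m : Type*} [Fintype m] [DecidableEq m] {W : Matrix m m ℂ} {N : ℕ}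

omit [DecidableEq m] in
/-- `Tr (Pᴴ Q) = Σ_{ij} conj P_{ij} Q_{ij}` (the Hilbert–Schmidt inner product). [cite: Bhatia1997, §I.2] -/
theorem lyap_trace_conjTranspose_mul (P Q : Matrix m m ℂ) :
    (Pᴴ * Q).trace = ∑ i, ∑ j, conj (P i j) * Q i j := by
  rw [Matrix.trace]
  simp only [Matrix.diag_apply, Matrix.mul_apply, Matrix.conjTranspose_apply, Complex.star_def]
  rw [Finset.sum_comm]

omit [DecidableEq m] in
/-- `Tr (Aᴴ A) = Σ_{ij} |A_{ij}|²` as a real number. [cite: Bhatia1997, §I.2] -/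
theorem lyap_re_trace_conjTranspose_mul_self (A : Matrix m m ℂ) :
    (Aᴴ * A).trace.re = ∑ i, ∑ j, ‖A i j‖ ^ 2 := by
  rw [lyap_trace_conjTranspose_mul, Complex.re_sum]
  refine Finset.sum_congr rfl fun i _ => ?_
  rw [Complex.re_sum]
  refine Finset.sum_congr rfl fun j _ => ?_
  rw [Complex.conj_mul', ← Complex.ofReal_pow, Complex.ofReal_re]

/-- **The conjugation preserves the Hilbert–Schmidt norm**: `Σ |A^_{ij}|² = Σ |A_{ij}|²` when
`Wᴴ W = N`. [cite: Bhatia1997, §I.2] -/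
theorem lyap_sum_normSq_hat (hN : N ≠ 0) (h1 : Wᴴ * W = (N : ℂ) • (1 : Matrix m m ℂ))
    (A : Matrix m m ℂ) :
    ∑ i, ∑ j, ‖((N : ℂ)⁻¹ • (W * A * Wᴴ)) i j‖ ^ 2 = ∑ i, ∑ j, ‖A i j‖ ^ 2 := by
  rw [← lyap_re_trace_conjTranspose_mul_self, ← lyap_re_trace_conjTranspose_mul_self,
    ← hat_conjTranspose, hat_mul hN h1, trace_hat hN h1]

/-- Unit row sums of `|V_{ij}|²` when `V Vᴴ = 1`. [folklore] -/
theorem lyap_row_normSq (V : Matrix m m ℂ) (h : V * Vᴴ = 1) (i : m) :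
    ∑ j, ‖V i j‖ ^ 2 = 1 := by
  have hij := congrFun (congrFun h i) i
  rw [Matrix.mul_apply, Matrix.one_apply_eq] at hij
  simp only [Matrix.conjTranspose_apply, Complex.star_def, Complex.mul_conj'] at hij
  have : ((∑ j, ‖V i j‖ ^ 2 : ℝ) : ℂ) = 1 := by
    rw [← hij]; push_cast; rfl
  exact_mod_cast this

/-- Unit column sums of `|V_{ij}|²` when `Vᴴ V = 1`. [folklore] -/
theorem lyap_col_normSq (V : Matrix m m ℂ) (h : Vᴴ * V = 1) (j : m) :
    ∑ i, ‖V i j‖ ^ 2 = 1 := by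
  have hjj := congrFun (congrFun h j) j
  rw [Matrix.mul_apply, Matrix.one_apply_eq] at hjj
  simp only [Matrix.conjTranspose_apply, Complex.star_def, Complex.conj_mul'] at hjj
  have : ((∑ i, ‖V i j‖ ^ 2 : ℝ) : ℂ) = 1 := by
    rw [← hjj]; push_cast; rfl
  exact_mod_cast this

omit [DecidableEq m] in
/-- The conjugation is additive. [folklore] -/
theorem hat_add (A B : Matrix m m ℂ) :
    (N : ℂ)⁻¹ • (W * (A + B) * Wᴴ) = (N : ℂ)⁻¹ • (W * A * Wᴴ) + (N : ℂ)⁻¹ • (W * B * Wᴴ) := by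
  rw [Matrix.mul_add, Matrix.add_mul, smul_add]

/-- **Admissibility of the optimal `Φ`.** With `E_pos = N⁻¹ Wᴴ diag(E) W` (`E > 0`) and `D^` the
transform of `D`: for every `α`,
`0 ≤ 2 Re Tr (Dᴴ α) + Re Tr (αᴴ (E_pos α + α E_pos)) + Σ_{kk'} |D^_{kk'}|²/(E_k + E_{k'})`
(mode by mode this is `lyap_scalar_amgm` with `e = E_k + E_{k'}`). [folklore] -/
theorem lyap_admissible {m : Type*} [Fintype m] [DecidableEq m] {W : Matrix m m ℂ} {N : ℕ} (hN : N ≠ 0) (h1 : Wᴴ * W = (N : ℂ) • (1 : Matrix m m ℂ)) (h2 : W * Wᴴ = (N : ℂ) • (1 : Matrix m m ℂ)) (E : m → ℝ) (hE : ∀ k, 0 < E k) (D α : Matrix m m ℂ) : 0 ≤ 2 * (Dᴴ * α).trace.re + (αᴴ * (((N : ℂ)⁻¹ • (Wᴴ * Matrix.diagonal (fun k => (E k : ℂ)) * W)) * α + α * ((N : ℂ)⁻¹ • (Wᴴ * Matrix.diagonal (fun k => (E k : ℂ)) * W)))).trace.re + ∑ k, ∑ k', ‖((N : ℂ)⁻¹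 • (W * D * Wᴴ)) k k'‖ ^ 2 / (E k + E k') := by
  set Dh : Matrix m m ℂ := (N : ℂ)⁻¹ • (W * D * Wᴴ) with hDh
  set A : Matrix m m ℂ := (N : ℂ)⁻¹ • (W * α * Wᴴ) with hA
  set Ep : Matrix m m ℂ := (N : ℂ)⁻¹ • (Wᴴ * Matrix.diagonal (fun k => (E k : ℂ)) * W) with hEp
  have hEhat : (N : ℂ)⁻¹ • (W * Ep * Wᴴ) = Matrix.diagonal (fun k => (E k : ℂ)) := hat_unhat hN h2 _
  -- transport both traces to momentum space
  have t1 : (Dᴴ * α).trace = (Dhᴴ * A).trace := by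
    rw [← trace_hat hN h1 (Dᴴ * α), ← hat_mul hN h1, hat_conjTranspose]
  have t2 : (αᴴ * (Ep * α + α * Ep)).trace =
      (Aᴴ * (Matrix.diagonal (fun k => (E k : ℂ)) * A + A * Matrix.diagonal (fun k => (E k : ℂ)))).trace := by
    rw [← trace_hat hN h1 (αᴴ * (Ep * α + α * Ep)), ← hat_mul hN h1, hat_conjTranspose, hat_add,
      ← hat_mul hN h1, ← hat_mul hN h1, hEhat]
  rw [t1, t2, lyap_trace_conjTranspose_mul, lyap_trace_conjTranspose_mul, Complex.re_sum,
    Complex.re_sum, Finset.mul_sum, ← Finset.sum_add_distrib, ← Finset.sum_add_distrib]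
  refine Finset.sum_nonneg fun k _ => ?_
  rw [Complex.re_sum, Complex.re_sum, Finset.mul_sum, ← Finset.sum_add_distrib,
    ← Finset.sum_add_distrib]
  refine Finset.sum_nonneg fun k' _ => ?_
  have hent : (Matrix.diagonal (fun k => (E k : ℂ)) * A + A * Matrix.diagonal (fun k => (E k : ℂ))) k k' =
      ((E k + E k' : ℝ) : ℂ) * A k k' := by
    rw [Matrix.add_apply, Matrix.diagonal_mul, Matrix.mul_diagonal]
    push_cast
    ring
  rw [hent, show conj (A k k') * (((E k + E k' : ℝ) : ℂ) * A k k') =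
      ((E k + E k' : ℝ) : ℂ) * (conj (A k k') * A k k') by ring, Complex.conj_mul',
    ← Complex.ofReal_pow, ← Complex.ofReal_mul, Complex.ofReal_re]
  exact lyap_scalar_amgm (add_pos (hE k) (hE k')) (Dh k k') (A k k')

end Scaled

end BirBdG

end Summit.HubbardSuperconductivity.HubbardSuperconductivity.Theorems

end
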